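import Mathlib.FieldTheory.IsAlgClosed.AlgebraicClosure
import Mathlib.FieldTheory.Perfect
import Mathlib.Algebra.Polynomial.Roots
import Mathlib.Algebra.CharP.Defs
import Literature.NumberTheory.DiophantineGeometry.LocalReduction
import Literature.NumberTheory.DiophantineGeometry.MinimalDiscriminant
import Literature.NumberTheory.DiophantineGeometry.KodairaSymbol
import HarnessLib

-- provenance: harness21/H21/H21/Prelude/DiophValNum/TateAlgorithm.lean @ 04f08e6 (interim HEAD d8f2665); M5 mechanical rewrite
/-!
# Tate's algorithm: the Kodaira symbol of a Weierstrass curve at a finite place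

Trunk: `DiophValNum` (item C4 `TateAlgorithm`).

Let `R` be a discrete valuation ring with maximal ideal `𝔪 = (π)`, residue field `k = R ⧸ 𝔪` and
fraction field `K`. Given a Weierstrass equation `W` over `K`, Tate's algorithm
(Tate 1975; Silverman, *Advanced Topics in the Arithmetic of Elliptic Curves* (ATAEC), IV.9.4)
determines the Kodaira–Néron type of the special fibre of the minimal proper regular model of `W`
over `R` by an explicit sequence of divisibility tests on the coefficients of successively translated
integral models. This file implements steps 1–10 of IV.9.4 *literally*, as a `noncomputable def`
`WeierstrassCurve.kodairaSymbolOfMinimal : WeierstrassCurve R → Literature.KodairaSymbol`. It is run on the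
integral minimal model `(W.minimal R).integralModel R` provided by Mathlib
(`Mathlib/AlgebraicGeometry/EllipticCurve/Reduction.lean`), so that step 11 of IV.9.4 ("the equation
was not minimal; divide by `π` and restart") never fires.

Mathlib has no Tate algorithm, Kodaira symbol or conductor (searched: `Kodaira`, `Tate.*algorithm`,
`kodaira`, `conductor` in `EllipticCurve/`); it does have `WeierstrassCurve.IsMinimal`, `minimal`,
`integralModel`, `HasGoodReduction`, `HasMultiplicativeReduction`, `HasAdditiveReduction`,
`IsDiscreteValuationRing.addVal`, `IsLocalRing.ResidueField`, `AlgebraicClosure`, `Polynomial.roots`,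
all of which are used here.

## Main definitions

* helpers in `namespace Literature.TateAlgorithm`: `uniformizer`, `distinctRootCount`, `divPow`, `redCoeff`
  (Silverman's `a_{i,j} = π^{-j} aᵢ mod π`), the normalising translations `normalizeStep2`,
  `normalizeStep6`, `normalizeStep8`, `normalizeStep9`, the auxiliary polynomials `cubicStep6`,
  `quadraticStep8`, and the `Iₙ*` sub-procedure `istarIndexAux` / `istarIndex` of step 7;
* `WeierstrassCurve.kodairaSymbolOfMinimal (W : WeierstrassCurve R) : Literature.KodairaSymbol` — steps 1–10;
* `WeierstrassCurve.kodairaSymbol R (W : WeierstrassCurve K)` — run on `(W.minimal R).integralModel R`;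
* `WeierstrassCurve.kodairaSymbolAt v W`, `WeierstrassCurve.numComponentsAt v W` — for a global curve
  `W / K` over a Dedekind domain `A` at a finite place `v`, computed in the completion as in
  `Literature.Prelude.DiophValNum.LocalReduction`.

## Design notes

* Everything is a plain `noncomputable def`; all choices are made through
  `if h : ∃ … then h.choose … else <junk>` and `Exists.choose`, never through `sorry`.
* **Dependence on choices.** `divPow`/`redCoeff` depend on the chosen uniformiser `π = uniformizer R`
  only up to units: replacing `π` by `u π` multiplies `a_{i,j}` by `u^{-j}`; the polynomials
  `cubicStep6`, `quadraticStep8` and the quadratics of `istarIndexAux` then change by `T ↦ u' T` and an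
  overall unit (`u'` a unit of `k`), which preserves the number of distinct roots in `k̄`. Likewise the
  chosen normalising translations are unique up to translations by elements of the appropriate power of
  `𝔪`, which change the auxiliary polynomials by `T ↦ T + c`. Hence, *when the residue field `k` is
  perfect* (the standing hypothesis of Tate 1975 and Silverman ATAEC §IV.9, under which no junk branch
  below is reached), the *output* is independent of all choices; this well-definedness (together with
  independence of the minimal model) is recorded as the single sorried lemma
  `WeierstrassCurve.kodairaSymbol_smul` (Tate 1975, §§7–8), stated under `[PerfectField k]`. For
  imperfect `k` of characteristic `2, 3` Tate's algorithm needs modification (Szydlo, *Elliptic fibers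
  over non-perfect residue fields*, J. Number Theory 104 (2004)) and nothing is claimed.
* **Junk branches.** Each `normalizeStepN W` is the identity if no suitable translation exists; the
  required translation exists whenever the residue field `k` is perfect (Silverman ATAEC IV.9.4 and
  Remark IV.9.5), in particular for finite `k`. The final `else` branch of `kodairaSymbolOfMinimal`
  returns the junk value `.I 0`; it corresponds to step 11 of IV.9.4 and is unreachable for a minimal
  equation over a DVR with perfect residue field. `istarIndexAux` returns the junk value `0` when its
  fuel (initialised to `ord Δ`, which bounds `n` since `ord Δ (Iₙ*) ≥ n + 6`) runs out.
  `distinctRootCount 0 = 0` (Mathlib's `Polynomial.roots 0 = 0`); only relevant if `a₂,₁ = 0` in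
  `istarIndexAux`, which cannot happen on valid input. For non-elliptic input (`Δ = 0`) the output
  is junk *and model-dependent*: step 2 returns `.I 0` if it fires (`addVal R 0 = ⊤`, `.toNat ⊤ = 0`),
  otherwise the algorithm runs on and may return `II`, …, or `.Istar 0` (`istarIndex` returns `0`
  since its fuel is `(addVal R 0).toNat = 0`), etc.; moreover Mathlib's `minimal` of a singular curve
  is an arbitrary integral model. All lemmas below therefore assume `[W.IsElliptic]`.
* **Perfectness hypotheses.** The lemmas resting on Tate's algorithm being correct
  (`kodairaSymbol_smul`, `isGood_kodairaSymbolAt_iff`, `isAdditive_kodairaSymbolAt_iff`,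
  `numComponentsAt_le`) assume the relevant residue field is perfect (`PerfectField`), as in the cited
  sources. `kodairaSymbolAt_eq_I_iff` and `ordMinimalDiscriminant_eq_numComponentsAt_add_one` do not
  need it: `.I n` with `n ≠ 0` is only produced by step 2, whose test is valid on any model, and in
  residue characteristic `≥ 5` all normalising translations exist over any residue field.
* Step 2 uses the test `b₂ ∉ 𝔪` on the *translated* model `W₂ = normalizeStep2 W` (Silverman's
  formulation); this is equivalent to `c₄ ∉ 𝔪` on `W`, i.e. to Mathlib's `HasMultiplicativeReduction`.
* Declarations in `namespace WeierstrassCurve` are deliberate dot-notation extensions of a Mathlib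
  namespace, as in `LocalReduction`.

## References

* J. Tate, *Algorithm for determining the type of a singular fiber in an elliptic pencil*, Modular
  Functions of One Variable IV, LNM 476, 1975, 33–52.
* J. H. Silverman, *Advanced Topics in the Arithmetic of Elliptic Curves*, GTM 151, 1994, §IV.9
  (Tate's algorithm 9.4), Table 4.1, §IV.10–11 (conductor, Ogg's formula 11.1).
* A. P. Ogg, *Elliptic curves and wild ramification*, Amer. J. Math. 89 (1967); T. Saito, *Conductor,
  discriminant, and the Noether formula of arithmetic surfaces*, Duke Math. J. 57 (1988).
-/

open Polynomial IsDedekindDomain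

namespace Literature.NumberTheory.DiophantineGeometry

namespace TateAlgorithm

section DVR

variable {R : Type*} [CommRing R] [IsDomain R] [IsDiscreteValuationRing R]

variable (R) in
/-- A chosen uniformiser `π` of the discrete valuation ring `R`, i.e. a chosen irreducible element
(`IsDiscreteValuationRing.exists_irreducible`). All uniformisers differ by units.
Silverman ATAEC IV.9.4 (notation `π`). [folklore] -/
noncomputable def uniformizer : R :=
  (IsDiscreteValuationRing.exists_irreducible R).choose

/-- The chosen uniformiser is irreducible. [folklore] -/
theorem irreducible_uniformizer : Irreducible (uniformizer R) :=
  (IsDiscreteValuationRing.exists_irreducible R).choose_spec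

open scoped Classical in
/-- The number of *distinct* roots of a polynomial `p` over the residue field
`k = IsLocalRing.ResidueField R` in an algebraic closure `k̄` of `k` (multiplicities ignored). This is
the quantity tested in steps 6, 7 and 8 of Tate's algorithm (Silverman ATAEC IV.9.4: "distinct roots
in `k̄`"). Written with Mathlib's `Polynomial.aroots`; it equals `(p.rootSet k̄).ncard`
(`Polynomial.rootSet_def`). It is invariant under `p ↦ c • p (u T + b)` for units `c, u` of `k` and
`b ∈ k`. Junk: `distinctRootCount 0 = 0` (`Polynomial.roots_zero`). [folklore] -/
noncomputable def distinctRootCount (p : (IsLocalRing.ResidueField R)[X]) : ℕ :=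
  (p.aroots (AlgebraicClosure (IsLocalRing.ResidueField R))).toFinset.card

open scoped Classical in
/-- `divPow a j = π^{-j} a` if `π ^ j ∣ a` (a chosen quotient, unique since `R` is a domain and
`π ≠ 0`), and the junk value `0` otherwise. Depends on the chosen uniformiser `π = uniformizer R` up to
the unit factor `u^{-j}` (see the module docstring). Silverman ATAEC IV.9.4 (notation `π^{-j} aᵢ`). [folklore] -/
noncomputable def divPow (a : R) (j : ℕ) : R :=
  if h : uniformizer R ^ j ∣ a then h.choose else 0

/-- `redCoeff a j = a_{·,j}`: the residue class in `k = R ⧸ 𝔪` of `π^{-j} a` (junk `0` if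
`π ^ j ∤ a`). This is Silverman's `a_{i,j} = π^{-j} aᵢ (mod π)` (ATAEC IV.9.4, notation before step 6).
Changing the uniformiser `π ↦ u π` multiplies it by `ū^{-j}`; see the module docstring for why this
does not affect the output of the algorithm. [folklore] -/
noncomputable def redCoeff (a : R) (j : ℕ) : IsLocalRing.ResidueField R :=
  IsLocalRing.residue R (divPow a j)

/-! ### Normalising translations -/

open scoped Classical in
/-- **Step 2 normalisation** (Silverman ATAEC IV.9.4, step 2): assuming `π ∣ Δ`, change coordinates
with `u = 1` (Silverman translates by `x ↦ x + r`, `y ↦ y + t`; any `u = 1` change achieving the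
conditions is allowed here) so that the singular point of the reduced curve is `(0, 0)`; afterwards
`π ∣ a₃`, `π ∣ a₄`, `π ∣ a₆`. If no such change of variables over `R` exists (this cannot happen
when the residue field is perfect) the equation is returned unchanged (junk branch). [folklore] -/
noncomputable def normalizeStep2 (W : WeierstrassCurve R) : WeierstrassCurve R :=
  if h : ∃ C : WeierstrassCurve.VariableChange R, C.u = 1 ∧
      (C • W).a₃ ∈ IsLocalRing.maximalIdeal R ∧ (C • W).a₄ ∈ IsLocalRing.maximalIdeal R ∧
      (C • W).a₆ ∈ IsLocalRing.maximalIdeal R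
    then h.choose • W else W

open scoped Classical in
/-- **Step 6 normalisation** (Silverman ATAEC IV.9.4, beginning of step 6): assuming steps 1–5 did
not terminate (so `π ∣ a₃, a₄`, `π² ∣ a₆`, `π³ ∣ b₆, b₈` on the step-2 model), change coordinates
with `u = 1` so that `π ∣ a₁`, `π ∣ a₂`, `π² ∣ a₃`, `π² ∣ a₄`, `π³ ∣ a₆`. Junk branch: identity if
no such change of variables exists (it exists when the residue field is perfect). [folklore] -/
noncomputable def normalizeStep6 (W : WeierstrassCurve R) : WeierstrassCurve R :=
  if h : ∃ C : WeierstrassCurve.VariableChange R, C.u = 1 ∧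
      (C • W).a₁ ∈ IsLocalRing.maximalIdeal R ∧ (C • W).a₂ ∈ IsLocalRing.maximalIdeal R ∧
      (C • W).a₃ ∈ IsLocalRing.maximalIdeal R ^ 2 ∧ (C • W).a₄ ∈ IsLocalRing.maximalIdeal R ^ 2 ∧
      (C • W).a₆ ∈ IsLocalRing.maximalIdeal R ^ 3
    then h.choose • W else W

open scoped Classical in
/-- **Step 8 normalisation** (Silverman ATAEC IV.9.4, step 8): if the step-6 cubic
`T³ + a₂,₁ T² + a₄,₂ T + a₆,₃` has a triple root in `k̄` (which then lies in `k` when `k` is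
perfect), change coordinates with `u = 1` (translate `x`) so that this root is `T = 0`; afterwards
`π ∣ a₁`, `π² ∣ a₂`, `π² ∣ a₃`, `π³ ∣ a₄`, `π⁴ ∣ a₆`. Junk branch: identity if no such change of
variables with `u = 1` exists. [folklore] -/
noncomputable def normalizeStep8 (W : WeierstrassCurve R) : WeierstrassCurve R :=
  if h : ∃ C : WeierstrassCurve.VariableChange R, C.u = 1 ∧
      (C • W).a₁ ∈ IsLocalRing.maximalIdeal R ∧ (C • W).a₂ ∈ IsLocalRing.maximalIdeal R ^ 2 ∧
      (C • W).a₃ ∈ IsLocalRing.maximalIdeal R ^ 2 ∧ (C • W).a₄ ∈ IsLocalRing.maximalIdeal R ^ 3 ∧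
      (C • W).a₆ ∈ IsLocalRing.maximalIdeal R ^ 4
    then h.choose • W else W

open scoped Classical in
/-- **Step 9 normalisation** (Silverman ATAEC IV.9.4, step 9): if the step-8 quadratic
`Y² + a₃,₂ Y − a₆,₄` has a double root, change coordinates with `u = 1` (translate `y`) so that it
is `Y = 0`; afterwards (in addition to the step-8 conditions) `π³ ∣ a₃` and `π⁵ ∣ a₆`. Junk branch:
identity if no such change of variables with `u = 1` exists. [folklore] -/
noncomputable def normalizeStep9 (W : WeierstrassCurve R) : WeierstrassCurve R :=
  if h : ∃ C : WeierstrassCurve.VariableChange R, C.u = 1 ∧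
      (C • W).a₁ ∈ IsLocalRing.maximalIdeal R ∧ (C • W).a₂ ∈ IsLocalRing.maximalIdeal R ^ 2 ∧
      (C • W).a₃ ∈ IsLocalRing.maximalIdeal R ^ 3 ∧ (C • W).a₄ ∈ IsLocalRing.maximalIdeal R ^ 3 ∧
      (C • W).a₆ ∈ IsLocalRing.maximalIdeal R ^ 5
    then h.choose • W else W

/-! ### Auxiliary polynomials over the residue field -/

/-- The cubic of **step 6** (Silverman ATAEC IV.9.4, step 6): `P(T) = T³ + a₂,₁ T² + a₄,₂ T + a₆,₃`
over the residue field, formed from the step-6 normalised model. Three distinct roots in `k̄` give type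
`I₀*`, a double root leads to `Iₙ*` (step 7), a triple root to steps 8–10. [folklore] -/
noncomputable def cubicStep6 (W : WeierstrassCurve R) : (IsLocalRing.ResidueField R)[X] :=
  X ^ 3 + C (redCoeff W.a₂ 1) * X ^ 2 + C (redCoeff W.a₄ 2) * X + C (redCoeff W.a₆ 3)

/-- The quadratic of **step 8** (Silverman ATAEC IV.9.4, step 8): `Y² + a₃,₂ Y − a₆,₄` over the
residue field, formed from the step-8 normalised model. Two distinct roots in `k̄` give type `IV*`. [folklore] -/
noncomputable def quadraticStep8 (W : WeierstrassCurve R) : (IsLocalRing.ResidueField R)[X] :=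
  X ^ 2 + C (redCoeff W.a₃ 2) * X - C (redCoeff W.a₆ 4)

/-! ### Step 7: the `Iₙ*` sub-procedure -/

open scoped Classical in
/-- The recursive part of **step 7** (Silverman ATAEC IV.9.4, step 7), with a fuel argument.
`istarIndexAux fuel m W` assumes `W` is normalised as at the start of round `m`, i.e. `π ∣ a₁`,
`π ∣ a₂`, `π^{m+2} ∣ a₃`, `π^{m+3} ∣ a₄`, `π^{2m+4} ∣ a₆` (on valid input automatically `π² ∤ a₂`;
only `a₂ ∈ 𝔪` is imposed below), and performs:
if `Y² + a₃,ₘ₊₂ Y − a₆,₂ₘ₊₄` has distinct roots in `k̄`, return `n = 2m + 1`; otherwise change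
coordinates with `u = 1` (Silverman: translate `y`) so that `π^{m+3} ∣ a₃`, `π^{2m+5} ∣ a₆`; then if
`a₂,₁ X² + a₄,ₘ₊₃ X + a₆,₂ₘ₊₅` has distinct roots in `k̄`, return `n = 2m + 2`; otherwise change
coordinates with `u = 1` (translate `x`) so that `π^{m+4} ∣ a₄`, `π^{2m+6} ∣ a₆` and continue with
round `m + 1`.
Junk values: a missing change of coordinates is replaced by the identity; when the fuel is exhausted
the value is `0` (unreachable when the fuel is at least `ord Δ`, since `ord Δ ≥ n + 6` for type
`Iₙ*`). [folklore] -/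
noncomputable def istarIndexAux : ℕ → ℕ → WeierstrassCurve R → ℕ
  | 0, _, _ => 0
  | fuel + 1, m, W =>
    if distinctRootCount
        (X ^ 2 + C (redCoeff W.a₃ (m + 2)) * X - C (redCoeff W.a₆ (2 * m + 4))) = 2 then
      2 * m + 1
    else
      let W' : WeierstrassCurve R :=
        if h : ∃ C : WeierstrassCurve.VariableChange R, C.u = 1 ∧
            (C • W).a₁ ∈ IsLocalRing.maximalIdeal R ∧ (C • W).a₂ ∈ IsLocalRing.maximalIdeal R ∧
            (C • W).a₃ ∈ IsLocalRing.maximalIdeal R ^ (m + 3) ∧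
            (C • W).a₄ ∈ IsLocalRing.maximalIdeal R ^ (m + 3) ∧
            (C • W).a₆ ∈ IsLocalRing.maximalIdeal R ^ (2 * m + 5)
          then h.choose • W else W
      if distinctRootCount (C (redCoeff W'.a₂ 1) * X ^ 2 + C (redCoeff W'.a₄ (m + 3)) * X +
          C (redCoeff W'.a₆ (2 * m + 5))) = 2 then
        2 * m + 2
      else
        let W'' : WeierstrassCurve R :=
          if h : ∃ C : WeierstrassCurve.VariableChange R, C.u = 1 ∧
              (C • W').a₁ ∈ IsLocalRing.maximalIdeal R ∧ (C • W').a₂ ∈ IsLocalRing.maximalIdeal R ∧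
              (C • W').a₃ ∈ IsLocalRing.maximalIdeal R ^ (m + 3) ∧
              (C • W').a₄ ∈ IsLocalRing.maximalIdeal R ^ (m + 4) ∧
              (C • W').a₆ ∈ IsLocalRing.maximalIdeal R ^ (2 * m + 6)
            then h.choose • W' else W'
        istarIndexAux fuel (m + 1) W''

open scoped Classical in
/-- **Step 7** of Tate's algorithm (Silverman ATAEC IV.9.4, step 7): the index `n ≥ 1` of the type
`Iₙ*`, for a step-6 normalised model `W` whose cubic `cubicStep6 W` has one simple and one double root
in `k̄`. First change coordinates with `u = 1` (translate `x`) so that the double root is `T = 0`,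
giving `π ∣ a₁`, `π ∣ a₂` (automatically `π² ∤ a₂`), `π² ∣ a₃`, `π³ ∣ a₄`, `π⁴ ∣ a₆` (identity as
junk if no such change of coordinates exists); then run `istarIndexAux` with fuel
`ord Δ = (addVal R W.Δ).toNat`. [folklore] -/
noncomputable def istarIndex (W : WeierstrassCurve R) : ℕ :=
  let W₇ : WeierstrassCurve R :=
    if h : ∃ C : WeierstrassCurve.VariableChange R, C.u = 1 ∧
        (C • W).a₁ ∈ IsLocalRing.maximalIdeal R ∧ (C • W).a₂ ∈ IsLocalRing.maximalIdeal R ∧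
        (C • W).a₃ ∈ IsLocalRing.maximalIdeal R ^ 2 ∧ (C • W).a₄ ∈ IsLocalRing.maximalIdeal R ^ 3 ∧
        (C • W).a₆ ∈ IsLocalRing.maximalIdeal R ^ 4
      then h.choose • W else W
  istarIndexAux (IsDiscreteValuationRing.addVal R W.Δ).toNat 0 W₇

end DVR

end TateAlgorithm

end Literature.NumberTheory.DiophantineGeometry

namespace WeierstrassCurve

open Literature.NumberTheory.DiophantineGeometry Literature.NumberTheory.DiophantineGeometry.TateAlgorithm

section DVR

variable {R : Type*} [CommRing R] [IsDomain R] [IsDiscreteValuationRing R]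
  {K : Type*} [Field K] [Algebra R K] [IsFractionRing R K]

open scoped Classical in
/-- **Tate's algorithm, steps 1–10** (Silverman ATAEC IV.9.4), for a Weierstrass equation `W` with
coefficients in the DVR `R` which is assumed to be *minimal* (so that step 11 never fires):
1. `π ∤ Δ` → `I₀`;
2. `W₂ := normalizeStep2 W`; `π ∤ b₂ (W₂)` → `Iₙ`, `n = ord Δ` (equivalently `π ∤ c₄ (W)`, Mathlib's
   `HasMultiplicativeReduction`; we use Silverman's `b₂` test on the translated model);
3. `π² ∤ a₆ (W₂)` → `II`;  4. `π³ ∤ b₈ (W₂)` → `III`;  5. `π³ ∤ b₆ (W₂)` → `IV`;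
6. `W₆ := normalizeStep6 W₂`, `P := cubicStep6 W₆`; three distinct roots → `I₀*`;
7. two distinct roots → `Iₙ*`, `n = istarIndex W₆`;
8. one root: `W₈ := normalizeStep8 W₆`, `Q := quadraticStep8 W₈`; two distinct roots → `IV*`;
9. `W₉ := normalizeStep9 W₈`; `π⁴ ∤ a₄ (W₉)` → `III*`;
10. `π⁶ ∤ a₆ (W₉)` → `II*`;
11. otherwise the junk value `I₀` (step 11 of IV.9.4: the equation was not minimal — unreachable for
    minimal `W` over a DVR with perfect residue field).

Further junk case: for `Δ = 0` (non-elliptic input) the output is junk and model-dependent (step 2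
returns `I₀` if it fires, since `addVal R 0 = ⊤` and `.toNat ⊤ = 0`; otherwise later steps may return
`II`, …, `I₀*` — `istarIndex` returns `0` on fuel `(addVal R 0).toNat = 0` —, etc.); all lemmas about
this definition assume `[W.IsElliptic]`.
(Dot-notation extension of the Mathlib namespace `WeierstrassCurve`.) [folklore] -/
noncomputable def kodairaSymbolOfMinimal (W : WeierstrassCurve R) : KodairaSymbol :=
  let 𝔪 := IsLocalRing.maximalIdeal R
  if W.Δ ∉ 𝔪 then .I 0
  else
    let W₂ := normalizeStep2 W
    if W₂.b₂ ∉ 𝔪 then .I (IsDiscreteValuationRing.addVal R W.Δ).toNat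
    else if W₂.a₆ ∉ 𝔪 ^ 2 then .II
    else if W₂.b₈ ∉ 𝔪 ^ 3 then .III
    else if W₂.b₆ ∉ 𝔪 ^ 3 then .IV
    else
      let W₆ := normalizeStep6 W₂
      let P := cubicStep6 W₆
      if distinctRootCount P = 3 then .Istar 0
      else if distinctRootCount P = 2 then .Istar (istarIndex W₆)
      else
        let W₈ := normalizeStep8 W₆
        if distinctRootCount (quadraticStep8 W₈) = 2 then .IVstar
        else
          let W₉ := normalizeStep9 W₈
          if W₉.a₄ ∉ 𝔪 ^ 4 then .IIIstar
          else if W₉.a₆ ∉ 𝔪 ^ 6 then .IIstar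
          else .I 0

variable (R) in
/-- The Kodaira symbol of a Weierstrass equation `W` over the fraction field `K` of the DVR `R`:
Tate's algorithm (`kodairaSymbolOfMinimal`) run on the integral minimal model
`(W.minimal R).integralModel R` (Mathlib). Independent of all choices when the residue field is
perfect (`kodairaSymbol_smul`); junk for singular `W` (then `W.minimal R` is an arbitrary integral
model). Tate 1975; Silverman ATAEC IV.9.4.
(Dot-notation extension of the Mathlib namespace `WeierstrassCurve`.) [cite: Tate1975] -/
noncomputable def kodairaSymbol (W : WeierstrassCurve K) : KodairaSymbol :=
  ((W.minimal R).integralModel R).kodairaSymbolOfMinimal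

/-- **Well-definedness of Tate's algorithm** (perfect residue field): the Kodaira symbol is an
invariant of the `K`-isomorphism class of `W`, i.e. independent of the Weierstrass model, of the
minimal model chosen by `WeierstrassCurve.minimal`, of the uniformiser and of the normalising
translations (it is the type of the special fibre of the minimal proper regular model). The hypothesis
`[PerfectField k]` is that of Tate 1975 and Silverman ATAEC §IV.9; without it the junk branches may be
reached and nothing is claimed. The hypothesis `[W.IsElliptic]` is necessary: for singular `W`
(`Δ = 0`) every integral model is `IsMinimal`, `W.minimal R` and `(C • W).minimal R` are unrelated
integral models, and `kodairaSymbolOfMinimal` is not constant on them (e.g. `y² = x³ + π x²` gives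
`I₀*` while the `K`-isomorphic `y² = x³ + π³ x²` gives the junk `I₀`). Mathlib provides the instance
`(C • W).IsElliptic`. Tate 1975, §§7–8; Silverman ATAEC IV.9.4 and Thm IV.8.2. [cite: Tate1975, and Silverman ATAEC §IV.9] -/
def kodairaSymbol_smul : Prop :=
  ∀ [PerfectField (IsLocalRing.ResidueField R)] (W : WeierstrassCurve K) [W.IsElliptic] (C : VariableChange K),
    (C • W).kodairaSymbol R = W.kodairaSymbol R

end DVR

section Local

variable {A : Type*} [CommRing A] [IsDedekindDomain A] {K : Type*} [Field K]
  [Algebra A K] [IsFractionRing A K] (v : HeightOneSpectrum A) (W : WeierstrassCurve K)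

/-- The Kodaira symbol of `W / K` at the finite place `v` of the Dedekind domain `A`: Tate's algorithm
run over the complete DVR `O_v = v.adicCompletionIntegers K` on the base change of `W` to
`K_v = v.adicCompletion K` (same convention as `LocalReduction`). Silverman ATAEC IV.9.4.
(Dot-notation extension of the Mathlib namespace `WeierstrassCurve`.) [folklore] -/
noncomputable def kodairaSymbolAt : KodairaSymbol :=
  (W.baseChange (v.adicCompletion K)).kodairaSymbol (v.adicCompletionIntegers K)

/-- `W.kodairaSymbolAt v` is Tate's algorithm run on the integral local minimal model
`W.localMinimalIntegralModel v` of `LocalReduction` (definitional). [folklore] -/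
theorem kodairaSymbolAt_def :
    W.kodairaSymbolAt v = (W.localMinimalIntegralModel v).kodairaSymbolOfMinimal :=
  rfl

/-- The number `m_v` of irreducible components (over `k̄`, without multiplicity) of the special fibre
of the minimal proper regular model of `W` at `v`, read off from the Kodaira symbol
(`Literature.NumberTheory.DiophantineGeometry.KodairaSymbol.numComponents`). Silverman ATAEC IV, Table 4.1; this is the `m_v` in Ogg's
formula `f_v = ord_v (Δ_min) + 1 − m_v` (ATAEC IV.11.1).
(Dot-notation extension of the Mathlib namespace `WeierstrassCurve`.) [folklore] -/
noncomputable def numComponentsAt : ℕ :=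
  (W.kodairaSymbolAt v).numComponents

/-- Tate's algorithm returns `I₀` exactly when `W` has good reduction at `v` (step 1 of Silverman
ATAEC IV.9.4 fires iff `v (Δ_min) = 0`; no later step returns `I₀` for a minimal equation over a
DVR with perfect residue field — hence the hypothesis `PerfectField` on the residue field of the
completion `O_v`). Silverman ATAEC IV.9.4, step 1; AEC VII.5.1(a). [cite: SilvermanATAEC1994, IV.9.4 step 1] [cite: SilvermanAEC2009, VII.5.1(a)] -/
def isGood_kodairaSymbolAt_iff : Prop :=
  ∀ [W.IsElliptic] [PerfectField (IsLocalRing.ResidueField (v.adicCompletionIntegers K))],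
    (W.kodairaSymbolAt v).IsGood ↔ W.HasGoodReductionAt v

/-- Tate's algorithm returns `Iₙ` with `n ≥ 1` exactly when `W` has multiplicative reduction at `v`,
and then `n = ord_v (Δ_min)`. No perfectness hypothesis is needed: `Iₙ`, `n ≠ 0`, is produced only
by step 2, whose test `b₂ (W₂) ∉ 𝔪 ⇔ c₄ ∉ 𝔪` is valid on any model over any residue field.
Silverman ATAEC IV.9.4, step 2; AEC VII.5.1(b). [cite: SilvermanATAEC1994, IV.9.4 step 2] [cite: SilvermanAEC2009, VII.5.1(b)] -/
def kodairaSymbolAt_eq_I_iff : Prop :=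
  ∀ [W.IsElliptic] {n : ℕ} (hn : n ≠ 0),
    W.kodairaSymbolAt v = .I n ↔
      W.HasMultiplicativeReductionAt v ∧ W.ordMinimalDiscriminant v = n

/-- The Kodaira symbol at `v` is of additive type (`II, III, IV, Iₙ*, IV*, III*, II*`) exactly when `W`
has additive reduction at `v` (perfect residue field, as in the source: otherwise the junk `I₀` of
step 11 may be returned). Silverman ATAEC IV.9.4, steps 3–10; AEC VII.5.1(c). [cite: SilvermanATAEC1994, IV.9.4 steps 3–10] [cite: SilvermanAEC2009, VII.5.1(c)] -/
def isAdditive_kodairaSymbolAt_iff : Prop :=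
  ∀ [W.IsElliptic] [PerfectField (IsLocalRing.ResidueField (v.adicCompletionIntegers K))],
    (W.kodairaSymbolAt v).IsAdditive ↔ W.HasAdditiveReductionAt v

/-- **Ogg–Saito**: the conductor exponent `f_v = ord_v (Δ_min) + 1 − m_v` is nonnegative, i.e.
`m_v ≤ ord_v (Δ_min) + 1` (perfect residue field, the setting of Ogg–Saito and of Tate's
algorithm). Ogg 1967; Saito 1988; Silverman ATAEC IV.11.1. [cite: Ogg1967] -/
def numComponentsAt_le : Prop :=
  ∀ [W.IsElliptic] [PerfectField (IsLocalRing.ResidueField (v.adicCompletionIntegers K))],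
    W.numComponentsAt v ≤ W.ordMinimalDiscriminant v + 1

/-- For additive reduction at a place `v` of residue characteristic different from `2` and `3` the
conductor is tame (`f_v = 2`, no wild part), so Ogg's formula reads `ord_v (Δ_min) = m_v + 1`
(Néron's table: `ord_v Δ = 2, 3, 4, n + 6, 8, 9, 10` for `II, III, IV, Iₙ*, IV*, III*, II*`).
No perfectness hypothesis is needed: in residue characteristic `≥ 5` every normalising translation
exists over any residue field (completing squares and cubes).
Silverman ATAEC IV.9.4 (the values of `v (Δ)` in the statement, valid for `p ≥ 5`), IV.10.4 and
IV.11.1. [cite: SilvermanATAEC1994, IV.9.4 (values of v(Δ), p ≥ 5), IV.10.4 and IV.11.1] -/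
def ordMinimalDiscriminant_eq_numComponentsAt_add_one : Prop :=
  ∀ [W.IsElliptic] (hadd : W.HasAdditiveReductionAt v) (h2 : ringChar (A ⧸ v.asIdeal) ≠ 2) (h3 : ringChar (A ⧸ v.asIdeal) ≠ 3),
    W.ordMinimalDiscriminant v = W.numComponentsAt v + 1

end Local

end WeierstrassCurve
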